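import Summits.AtomisticToContinuum.HydrodynamicLimit.Theorems.InformationPercolationEngineCollisionMomentBoundRung0
import Summits.AtomisticToContinuum.HydrodynamicLimit.Theses.InformationPercolationEngine
import HarnessLib

/-!
# `CollisionMomentBound` for GENERAL local Gibbs profiles from the pair collision-flux bound under the evolved law

Helper for the support item `InformationPercolationEngine.CollisionMomentBound` (stmt-AtomisticToContinuum-15144), lead c6 of the
crux line `Sketch` of `InformationPercolationEngine.CollisionRate` (stmt-AtomisticToContinuum-13481, skeleton v22 §C).

The route decl `CollisionMomentBound` asks, for every continuous positive local Gibbs profile, small `σ`, every hard-sphere flow family,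
`τ > 0` and `δ > 0`, for a threshold `K_b` and `N₀` with `LG_N{K_b < K_N[1 + ‖vᵢ‖² + ‖vⱼ‖²]} ≤ δ` (`N ≥ N₀`), `K_N[F] = ε_N (N+1)⁻¹ Σ_{collision
times s ≤ τ} Σ_{ordered contact pairs} F`.  At rung 0 (constant profiles) this is `collisionMomentBound_const` (this directory,
`…CollisionMomentBoundRung0.lean`): the Cercignani–Illner–Pulvirenti collision-flux bound in Markov form for the mark `b(v,w) = 1 + ‖v‖² + ‖w‖²`.
Here the SAME proof is run for general profiles, taking as hypothesis the general-profile collision-flux bound in Markov form under the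
(non-invariant) local Gibbs law — the shape `CollisionMarkFluxLG` of the crux line, which is a THEOREM given the marginal envelope (A) of the
evolved law (`Theorems.CollisionRate.stub_collisionMarkFluxLG_of_envelope`, file `…CollisionRateCollisionMarkFluxLGOfEnvelope.lean`, p132848):
so `CollisionMomentBound ⇐ (A)`, the composition being the one-liner
`collisionMomentBound_of_collisionMarkFlux (stub_collisionMarkFluxLG_of_envelope hA)`.

References: C. Cercignani, R. Illner, M. Pulvirenti, *The Mathematical Theory of Dilute Gases* (1994), §4.3 and App. 4.A;
H. Spohn, *Large Scale Dynamics of Interacting Particles* (1991), Part I §3.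
-/

noncomputable section

open MeasureTheory Set Filter Topology
open scoped ENNReal

namespace Summit.AtomisticToContinuum.HydrodynamicLimit.Theorems.CollisionMomentBound

open Literature.Analysis.FluidPDE Literature.MathematicalPhysics.KineticTheory

/-- **`CollisionMomentBound` from the pair collision-flux bound under the evolved local Gibbs law.**  IF for every continuous positive
profile, small `σ`, every flow family and horizon `τ > 0` there are `C ≥ 0`, a reference Maxwellian `N(u,θ)` and `N₀` such that for `N ≥ N₀`,
every sub-horizon `0 < τ' ≤ τ`, every measurable mark `b ≥ 0` of the two velocities and `η > 0`,
`LG{z good, Σ_{collisions in [0,τ']} b(vᵢ, vⱼ) ≥ η} ≤ η⁻¹ · C τ' (N+1)² ε² · ∫ ‖w − v‖ b d(N(u,θ) ⊗ N(u,θ))` (the hypothesis; the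
shape `CollisionMarkFluxLG` of the crux line `Sketch` of stmt-13481, proved there from the marginal envelope of the evolved law), THEN
`CollisionMomentBound`: with `I := ∫ ‖w − v‖(1 + ‖v‖² + ‖w‖²) dN(u,θ)^{⊗2} < ∞` (`lintegral_fluxMoment_ne_top`) and
`K_b := C τ σ³ I/δ + 1`, the event `{K_b < K_N[1 + ‖vᵢ‖² + ‖vⱼ‖²]}` lies in `goodᶜ ∪ {K_b (N+1)/ε ≤ Σ_coll b}`, of probability
`≤ (ε/((N+1)K_b)) · C τ (N+1)² ε² · I = C τ σ³ I/K_b ≤ δ` (`(N+1) ε³ = σ³`). [folklore] -/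
theorem collisionMomentBound_of_collisionMarkFlux
    (hF : ∀ (a₀ θ₀ : T3 → ℝ) (u₀ : T3 → V3), Continuous a₀ → Continuous θ₀ → Continuous u₀ →
      (∀ x, 0 < a₀ x) → (∀ x, 0 < θ₀ x) → ∃ σ₀ : ℝ, 0 < σ₀ ∧ ∀ σ : ℝ, 0 < σ → σ < σ₀ →
      ∀ Φ : (N : ℕ) → HardSphereFlow (Torus.geometry (Fin 3)) (hsDiameter σ N) (N + 1),
      ∀ τ : ℝ, 0 < τ → ∃ C : ℝ, 0 ≤ C ∧ ∃ u : V3, ∃ θ : ℝ, 0 < θ ∧ ∃ N₀ : ℕ, ∀ N : ℕ, N₀ ≤ N →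
      ∀ τ' : ℝ, 0 < τ' → τ' ≤ τ → ∀ b : V3 × V3 → ℝ, Measurable b → (∀ p, 0 ≤ b p) → ∀ η : ℝ, 0 < η →
        localGibbsLaw σ a₀ u₀ θ₀ N (Φ N)
            {z | z ∈ (Φ N).good ∧ η ≤ ∑ᶠ s ∈ collisionTimes (Torus.geometry (Fin 3)) (hsDiameter σ N)
                (fun t => (Φ N).flow t z) ∩ Set.Icc 0 τ',
              ∑ i : Fin (N + 1), ∑ j : Fin (N + 1),
                (if i ≠ j ∧ ‖(Torus.geometry (Fin 3)).sepVec ((Φ N).flow s z i).1 ((Φ N).flow s z j).1‖ =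
                    hsDiameter σ N then b (((Φ N).flow s z i).2, ((Φ N).flow s z j).2) else 0)} ≤
          (ENNReal.ofReal η)⁻¹ * (ENNReal.ofReal (C * τ' * ((N + 1 : ℕ) : ℝ) ^ 2 * hsDiameter σ N ^ 2) *
            ∫⁻ p, ENNReal.ofReal (‖p.2 - p.1‖ * b p) ∂((gaussMeasure u θ).prod (gaussMeasure u θ)))) :
    _root_.Summit.AtomisticToContinuum.HydrodynamicLimit.Theses.InformationPercolationEngine.CollisionMomentBound := by
  classical
  unfold Summit.AtomisticToContinuum.HydrodynamicLimit.Theses.InformationPercolationEngine.CollisionMomentBound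
  intro a₀ θ₀ u₀ ha hθ hu ha0 hθ0
  obtain ⟨σ₀, hσ₀, HF⟩ := hF a₀ θ₀ u₀ ha hθ hu ha0 hθ0
  refine ⟨σ₀, hσ₀, fun σ hσ hσlt Φ τ hτ δ hδ => ?_⟩
  obtain ⟨C, hC, u, θ, _hθ', N₀, HF⟩ := HF σ hσ hσlt Φ τ hτ
  -- the Gaussian flux-weighted second moment and the threshold
  set b : V3 × V3 → ℝ := fun p => 1 + ‖p.1‖ ^ 2 + ‖p.2‖ ^ 2 with hb
  have hbm : Measurable b := by rw [hb]; fun_prop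
  have hb0 : ∀ p, 0 ≤ b p := fun p => by rw [hb]; positivity
  set I : ℝ≥0∞ := ∫⁻ p, ENNReal.ofReal (‖p.2 - p.1‖ * b p)
    ∂((gaussMeasure u θ).prod (gaussMeasure u θ)) with hI
  have hItop : I ≠ ⊤ := lintegral_fluxMoment_ne_top u θ
  set Ir : ℝ := I.toReal with hIr
  have hIr0 : 0 ≤ Ir := ENNReal.toReal_nonneg
  have hIeq : I = ENNReal.ofReal Ir := (ENNReal.ofReal_toReal hItop).symm
  set Kb : ℝ := C * τ * σ ^ 3 * Ir / δ + 1 with hKb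
  have hKb0 : 0 < Kb := by rw [hKb]; positivity
  refine ⟨Kb, N₀, fun N hN => ?_⟩
  -- notation
  set ε := hsDiameter σ N with hεdef
  have hε : 0 < ε := hsDiameter_pos hσ N
  set P := localGibbsLaw σ a₀ u₀ θ₀ N (Φ N) with hP
  set Mu : ℝ := ε / (N + 1 : ℝ) with hMu
  have hMu0 : 0 < Mu := by rw [hMu]; positivity
  set η' : ℝ := Kb / Mu with hη'
  have hη'0 : 0 < η' := div_pos hKb0 hMu0
  -- the event of a large `b`-collision sum on the good set, bounded by the flux bound at `τ' = τ`
  set B : Set (Config (N + 1) (Fin 3) T3) := {z | z ∈ (Φ N).good ∧ η' ≤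
      ∑ᶠ s ∈ collisionTimes (Torus.geometry (Fin 3)) ε (fun t => (Φ N).flow t z) ∩ Icc 0 τ,
        ∑ i : Fin (N + 1), ∑ j : Fin (N + 1),
          (if i ≠ j ∧ ‖(Torus.geometry (Fin 3)).sepVec ((Φ N).flow s z i).1 ((Φ N).flow s z j).1‖ = ε
            then b (((Φ N).flow s z i).2, ((Φ N).flow s z j).2) else 0)} with hB
  have hBle : P B ≤ (ENNReal.ofReal η')⁻¹ * (ENNReal.ofReal (C * τ * ((N + 1 : ℕ) : ℝ) ^ 2 * ε ^ 2) * I) :=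
    HF N hN τ hτ le_rfl b hbm hb0 η' hη'0
  have hsub : {z : Config (N + 1) (Fin 3) T3 | Kb < Mu *
      ∑ᶠ (s : ℝ) (_ : s ∈ collisionTimes (Torus.geometry (Fin 3)) ε (fun t => (Φ N).flow t z) ∩ Icc 0 τ),
        ∑ i : Fin (N + 1), ∑ j : Fin (N + 1),
          (if i ≠ j ∧ ‖(Torus.geometry (Fin 3)).sepVec ((Φ N).flow s z i).1 ((Φ N).flow s z j).1‖ = ε
            then 1 + ‖((Φ N).flow s z i).2‖ ^ 2 + ‖((Φ N).flow s z j).2‖ ^ 2 else 0)} ⊆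
      (Φ N).goodᶜ ∪ B := by
    intro z hz
    by_cases hgood : z ∈ (Φ N).good
    · refine Or.inr ⟨hgood, ?_⟩
      rw [hη']
      exact (div_le_iff₀' hMu0).2 (le_of_lt hz)
    · exact Or.inl hgood
  have hgood0 : P (Φ N).goodᶜ = 0 := by
    rw [hP, localGibbsLaw_eq]
    exact localGibbsMeasure_absolutelyContinuous σ _ _ _ N (Φ N) (Φ N).measure_compl_good
  -- the arithmetic of the constants
  have hε3 : ((N + 1 : ℕ) : ℝ) * ε ^ 3 = σ ^ 3 := succ_mul_hsDiameter_pow_three σ N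
  have hkey : η'⁻¹ * (C * τ * ((N + 1 : ℕ) : ℝ) ^ 2 * ε ^ 2) * Ir ≤ δ := by
    have h1 : η'⁻¹ * (C * τ * ((N + 1 : ℕ) : ℝ) ^ 2 * ε ^ 2) * Ir =
        C * τ * (((N + 1 : ℕ) : ℝ) * ε ^ 3) * Ir / Kb := by
      rw [hη', hMu]
      push_cast
      field_simp
    rw [h1, hε3, div_le_iff₀ hKb0, hKb, mul_add, mul_one, mul_div_cancel₀ _ hδ.ne']
    linarith [mul_nonneg (mul_nonneg (mul_nonneg (mul_nonneg hC hτ.le) (pow_nonneg hσ.le 3)) hIr0) hδ.le]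
  show P _ ≤ ENNReal.ofReal δ
  calc P _ ≤ P ((Φ N).goodᶜ ∪ B) := measure_mono hsub
    _ ≤ P (Φ N).goodᶜ + P B := measure_union_le _ _
    _ ≤ 0 + (ENNReal.ofReal η')⁻¹ * (ENNReal.ofReal (C * τ * ((N + 1 : ℕ) : ℝ) ^ 2 * ε ^ 2) * I) := by
        rw [hgood0]
        exact add_le_add le_rfl hBle
    _ = ENNReal.ofReal (η'⁻¹ * (C * τ * ((N + 1 : ℕ) : ℝ) ^ 2 * ε ^ 2) * Ir) := by
        rw [zero_add, hIeq, ← ENNReal.ofReal_inv_of_pos hη'0,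
          ← ENNReal.ofReal_mul (by positivity), ← ENNReal.ofReal_mul (by positivity)]
        congr 1
        ring
    _ ≤ ENNReal.ofReal δ := ENNReal.ofReal_le_ofReal hkey

end Summit.AtomisticToContinuum.HydrodynamicLimit.Theorems.CollisionMomentBound

end
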